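import Literature.NumberTheory.Automorphic.ReciprocityGLnExistenceProofs
import Mathlib.NumberTheory.NumberField.CMField
import HarnessLib

/-!
# Crux `GaloisRepGL2CMae` (stmt-Langlands-16722), line `Sketch`: the representation of a member (rank 2)

Helper file of the crux line `Cruxes/GaloisRepGL2CMae/Lines/Sketch.lean` (`--supports
stmt-Langlands-16722`): the three lemmas feeding the registered stub S7 `stub_patching` (sibling file
`IrreducibilityBySelfDualityGaloisRepGL2CMaePatching.lean`), i.e. the member-wise half of the
**patching step at `n = 2`, almost everywhere, with the unramified alternative only**

  `Thm713UnramTwoCM → ACArchTwo → ACCuspTwo → GaloisRepGL2CMae` (body),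

where `Thm713UnramTwoCM` is Harris–Lan–Taylor–Thorne's Thm. 7.13 at `n = 2` for CM fields
`K ⊇ E₀` (imaginary quadratic, `p` split in `E₀`) with ONLY the second printed alternative on `q`
("`F` and `π` unramified above `q`"), and `ACArchTwo`, `ACCuspTwo` are the `n = 2` instances of
Arthur–Clozel's archimedean clause (`ArthurClozel1989_strongLifting_archimedean`) and strong cuspidal
prime-degree base change (`ArthurClozel1989_strongLifting_cuspidal`, route item
`ACStrongCuspidalBaseChangePrime`).

Proof (HLTT Cor. 7.14, p. 232, "by using lemma 1 of [54] … the same argument used in the proof of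
theorem VII.1.9 of [29]", run at `n = 2` and read off only almost everywhere).  Exactly as the tree's
`HarrisLanTaylorThorne2016.exists_rep_member` / `theoremA_existence_of_baseChange`
(`ReciprocityGLnExistenceProofs`): the members `K_D = K(√-D)`, `D ∈ GoodPrime K (8ℓ) B` (`B` the
finitely many rational primes below a place ramified over `ℤ` or a ramified place of `σ`), are CM
with the imaginary quadratic subfield `ℚ(√-D)` in which `ℓ` and every `q` with `8q ∣ D + 1` split;
the strong base change `σ_D` (hypothesis `ACCuspTwo`, cuspidal by Chenevier–Harris's criterion at the
ramified place above `D`) is regular algebraic (`ACArchTwo`); Thm. 7.13 (hypothesis) gives a semisimple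
`ρ_D : Γ_{K_D} → GL₂(ℚ̄_ℓ)` compatible almost everywhere with the Frobenius datum of `σ`
(`CompatibleAE`) and — NEW w.r.t. `exists_rep_member` (ii), which used the first alternative
"`q` splits in `ℚ(√-D)`" — compatible at every place over every `v ∣ q` for the rational primes
`q ∉ B ∪ {ℓ}` with `8q ∣ D + 1`: every place of `K` over such a `q` splits completely in `K_D`
(`ncard_primesOver_sqrtNegField_eq_two`), so `q`, unramified in `K`, stays unramified in `K_D`
(`isUnramifiedIn_sqrtNegField_of_dvd`, multiplicativity of ramification indices), and the SECOND
alternative of Thm. 7.13 applies.  Sorensen patching (`GoodPrime.exists_framedGaloisRep_of_compatibleAE`,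
proved) with `T` = the places over the rational primes `q ∉ B ∪ {ℓ}` then yields `r : Γ_K → GL₂(ℚ̄_ℓ)`
compatible with `σ` at every `v ∈ T`, a cofinite set of places.

References: Harris–Lan–Taylor–Thorne, Res. Math. Sci. 3:37 (2016), Thm. 7.13, Cor. 7.14 (p. 232)
[HarrisLanTaylorThorneRMS2016]; Harris–Taylor, Ann. of Math. Stud. 151, proof of Thm. VII.1.9
[HarrisTaylorAMS2001]; Arthur–Clozel, Ann. of Math. Stud. 120, Ch. 3 Thms. 4.2, 5.1 [ArthurClozelAMS120];
C. Sorensen, A patching lemma (2020) [Sorensen2020].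
-/

noncomputable section

set_option linter.dupNamespace false -- project-wide option; `Summit.Langlands.Langlands` is the mandated namespace (D-0017)

open scoped MatrixGroups Matrix NumberField Polynomial
open NumberField IsDedekindDomain Field Polynomial Filter
open Literature.NumberTheory.Automorphic Literature.NumberTheory.GaloisRepresentations
open Literature.NumberTheory.GaloisRepresentations.QuadraticFamily
open Literature.NumberTheory.Automorphic.PatchingFamily
open Literature.NumberTheory.Automorphic.HarrisLanTaylorThorne2016

namespace Summit.Langlands.Langlands.Theorems.GaloisRepGL2CMae

/-! ### A rational prime unramified in `K` splitting in `ℚ(√-D)` is unramified in `K(√-D)` -/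

section Unramified

variable {K : Type} [Field K] [NumberField K] {D : ℕ} [Fact (¬ IsSquare (-(D : K)))]

/-- **`q` unramified in `K` and `8q ∣ D + 1` ⇒ `q` unramified in `K(√-D)`.**  Every place `v` of
`K` over `q` splits completely in `K(√-D)` (`-D` is a square in `K_v`,
`ncard_primesOver_sqrtNegField_eq_two`), hence is unramified in `K(√-D)/K`
(`isUnramifiedIn_of_ncard_eq_finrank`); ramification indices multiply in the tower
`ℤ ⊆ 𝓞_K ⊆ 𝓞_{K(√-D)}` (Mathlib `Ideal.ramificationIdx_tower`), so `e(𝔔 | q) = 1 · 1`.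
[folklore] -/
theorem isUnramifiedIn_sqrtNegField_of_dvd {q : ℕ} (hq : q.Prime) (hqD : 8 * q ∣ D + 1)
    (hK : Algebra.IsUnramifiedIn (𝓞 K) (Ideal.span {(q : ℤ)})) :
    Algebra.IsUnramifiedIn (𝓞 (sqrtNegField K D)) (Ideal.span {(q : ℤ)}) := by
  rw [Algebra.isUnramifiedIn_iff_forall_ramificationIdx_eq_one] at hK ⊢
  intro 𝔔 _ h𝔔
  have hq0 : (q : ℤ) ≠ 0 := by exact_mod_cast hq.ne_zero
  -- the prime `𝔮 = 𝔔 ∩ 𝓞 K` of `K` below `𝔔`, over `(q)`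
  set 𝔮 : Ideal (𝓞 K) := 𝔔.under (𝓞 K) with h𝔮
  haveI : 𝔮.IsPrime := Ideal.IsPrime.under _ 𝔔
  haveI : 𝔔.LiesOver 𝔮 := ⟨rfl⟩
  haveI h𝔮q : 𝔮.LiesOver (Ideal.span {(q : ℤ)}) := ⟨by
    rw [h𝔮, Ideal.under_under]
    exact h𝔔.over⟩
  have hqmem : ((q : ℕ) : 𝓞 K) ∈ 𝔮 := by
    have : ((q : ℤ) : 𝓞 K) ∈ 𝔮 := by
      have h := Ideal.mem_span_singleton_self (q : ℤ)
      rw [h𝔮q.over, Ideal.under_def, Ideal.mem_comap] at h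
      simpa using h
    simpa using this
  have h𝔮0 : 𝔮 ≠ ⊥ := by
    intro h
    rw [h, Ideal.mem_bot] at hqmem
    exact hq.ne_zero (by exact_mod_cast hqmem)
  let v : HeightOneSpectrum (𝓞 K) := ⟨𝔮, inferInstance, h𝔮0⟩
  -- `e(𝔮 | q) = 1`
  have h1 : 𝔮.ramificationIdx ℤ = 1 := hK 𝔮 h𝔮q
  -- `e(𝔔 | 𝔮) = 1`: `v` splits completely in `K(√-D)`
  have hsplit : (v.asIdeal.primesOver (𝓞 (sqrtNegField K D))).ncard =
      Module.finrank K (sqrtNegField K D) := by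
    rw [finrank_sqrtNegField]
    exact ncard_primesOver_sqrtNegField_eq_two v hq hqmem hqD
  have h2 : 𝔔.ramificationIdx (𝓞 K) = 1 :=
    (isUnramifiedIn_of_ncard_eq_finrank v hsplit).ramificationIdx_eq_one (𝔓 := 𝔔) ⟨rfl⟩
  rw [Ideal.ramificationIdx_tower (R := ℤ) 𝔮 𝔔, h1, h2]

end Unramified

/-! ### Regular algebraicity ascends along strong base change (rank `2`) -/

section Arch

variable {F E : Type} [Field F] [NumberField F] [Field E] [NumberField E] [Algebra F E]
  [IsGalois F E] {hF : isCompact_glFiniteIntegralLevel 2 F} {hE : isCompact_glFiniteIntegralLevel 2 E}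

/-- **A strong base change of a regular algebraic `π` on `GL₂` is regular algebraic**, granted
Arthur–Clozel's archimedean clause at `n = 2` (hypothesis `harch`, the `n = 2` instance of
`ArthurClozel1989_strongLifting_archimedean`): the Satake relation at every place over an unramified
`v` holds almost everywhere, so `P` is a weak base-change lift and its infinity type is `τ ↦ T(τ|_F)`.
(Rank-`2` copy of `HarrisLanTaylorThorne2016.isRegularAlgebraic_of_strongBaseChange`.)
[cite: ArthurClozelAMS120, Ch. 3 Thm. 5.1 and Ch. 1 §7] -/
theorem isRegularAlgebraic_of_strongBaseChange_two
    (harch : ∀ (F E : Type) [Field F] [NumberField F] [Field E] [NumberField E] [Algebra F E]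
      [IsGalois F E] (hF : isCompact_glFiniteIntegralLevel 2 F)
      (hE : isCompact_glFiniteIntegralLevel 2 E), IsCyclic (E ≃ₐ[F] E) →
        (Module.finrank F E).Prime →
          ∀ (π : CuspidalAutomorphicRepData 2 F hF) (P : CuspidalAutomorphicRepData 2 E hE),
            IsWeakBaseChangeLiftAE π.1 P.1 →
              ∀ χ : (F →+* ℂ) → Multiset ℂ, π.1.HasArchParameter χ →
                P.1.HasArchParameter fun τ => χ (τ.comp (algebraMap F E)))
    (hl : (Module.finrank F E).Prime) {π : CuspidalAutomorphicRepData 2 F hF}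
    {P : CuspidalAutomorphicRepData 2 E hE}
    (h : ∀ (w : HeightOneSpectrum (𝓞 E)) (v : HeightOneSpectrum (𝓞 F)) (α : Multiset ℂ),
      w.asIdeal.under (𝓞 F) = v.asIdeal → Algebra.IsUnramifiedIn (𝓞 E) v.asIdeal →
        π.1.HasSatakeParamAt v α → P.1.HasSatakeParamAt w (α.map (· ^ w.asIdeal.inertiaDeg (𝓞 F))))
    (hπ : π.1.IsRegularAlgebraic) : P.1.IsRegularAlgebraic := by
  haveI hcyc : IsCyclic (E ≃ₐ[F] E) :=
    isCyclic_of_prime_card (p := Module.finrank F E) (hp := ⟨hl⟩) (IsGalois.card_aut_eq_finrank F E)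
  -- strong ⇒ weak
  have hfin : ∀ᶠ v : HeightOneSpectrum (𝓞 F) in cofinite,
      Algebra.IsUnramifiedIn (𝓞 E) v.asIdeal := by
    filter_upwards [(finite_setOf_not_isUnramifiedIn F E).compl_mem_cofinite]
      with v hv
    simpa using hv
  have hweak : IsWeakBaseChangeLiftAE π.1 P.1 := by
    filter_upwards [eventually_under (E := E) hfin] with w hw v α hwv hα
    exact h w v α hwv (hw v hwv) hα
  obtain ⟨T, hT, hTra⟩ := hπ
  refine ⟨T.baseChange E, ⟨hT.1.baseChange, ?_⟩, hTra.1.baseChange, hTra.2.baseChange⟩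
  have := harch F E hF hE hcyc hl π P hweak (fun σ => (T σ).map ArchWeight.a) hT.2
  simpa [InfinityType.baseChange] using this

end Arch

/-! ### The representation of a member, unramified alternative -/

section Member

/-- **The representation of a member, at `n = 2`, from Thm. 7.13 with the unramified alternative
only.**  `K` CM, `π` regular algebraic cuspidal on `GL₂(𝔸_K)`, `E` a Frobenius datum of `π`, `B` a set
of rational primes containing every prime below a place of `K` ramified over `ℤ` or a ramified place
of `π`, `D ∈ GoodPrime K (8ℓ) B`.  Granted Thm. 7.13 at `n = 2` for CM fields containing an imaginary
quadratic field in which `ℓ` splits, SECOND alternative only (`h713`), and the two Arthur–Clozel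
clauses at `n = 2` (`harch`, `hBC`): the strong base change `π_D` of `π` to `K_D = K(√-D)` is cuspidal
regular algebraic, `K_D ⊇ ℚ(√-D) ∋` split `ℓ`, and `ρ = r_{ℓ,ı}(π_D)` is semisimple with **(i)** `ρ`
compatible almost everywhere with `E` (verbatim part (i) of `exists_rep_member`), and **(ii′)** for a
rational prime `q ≠ ℓ` UNRAMIFIED IN `K`, above which `π` is unramified, with `8q ∣ D + 1`: every
place of `K` over `q` splits completely in `K_D`, so `π_D` is unramified above `q`, `q` is unramified
in `K_D` (`isUnramifiedIn_sqrtNegField_of_dvd`) and the second alternative of Thm. 7.13 gives, at every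
`w` over every `v ∣ q`, `ρ` unramified with characteristic polynomial `arithFrobPolyOfSatake ı q_v 2 α_v`
(`f(w|v) = 1`, `q_w = q_v`).
[cite: HarrisLanTaylorThorneRMS2016, Thm. 7.13 and proof of Cor. 7.14 (p. 232)]
[cite: HarrisTaylorAMS2001, proof of Thm. VII.1.9 (pp. 229–231)] -/
theorem exists_rep_member_two :
    ∀ {K : Type} [Field K] [NumberField K] {hcpt : isCompact_glFiniteIntegralLevel 2 K}
      {ℓ : ℕ} [Fact ℓ.Prime],
    (∀ (K : Type) [Field K] [NumberField K], IsCMField K →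
      ∀ (hcpt : isCompact_glFiniteIntegralLevel 2 K) (p : ℕ) [Fact p.Prime]
        (E₀ : IntermediateField ℚ K), Module.finrank ℚ E₀ = 2 ∧ IsTotallyComplex E₀ →
        HasTwoPrimesOver E₀ p →
      ∀ (π : CuspidalAutomorphicRepData 2 K hcpt), π.1.IsRegularAlgebraic →
      ∀ (ι : PadicAlgCl p ≃+* ℂ),
      ∃ r : FramedGaloisRep K (PadicAlgCl p) 2, r.toGaloisRep.IsSemisimple ∧
        ∀ q : ℕ, q.Prime → q ≠ p → Algebra.IsUnramifiedIn (𝓞 K) (Ideal.span {(q : ℤ)}) →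
          π.1.IsUnramifiedAbove q →
          ∀ v : HeightOneSpectrum (𝓞 K), ((q : ℕ) : 𝓞 K) ∈ v.asIdeal →
            IsGaloisCompatibleAt π.1 ι r v) →
    (∀ (F E : Type) [Field F] [NumberField F] [Field E] [NumberField E] [Algebra F E]
      [IsGalois F E] (hF : isCompact_glFiniteIntegralLevel 2 F)
      (hE : isCompact_glFiniteIntegralLevel 2 E), IsCyclic (E ≃ₐ[F] E) →
        (Module.finrank F E).Prime →
          ∀ (π : CuspidalAutomorphicRepData 2 F hF) (P : CuspidalAutomorphicRepData 2 E hE),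
            IsWeakBaseChangeLiftAE π.1 P.1 →
              ∀ χ : (F →+* ℂ) → Multiset ℂ, π.1.HasArchParameter χ →
                P.1.HasArchParameter fun τ => χ (τ.comp (algebraMap F E))) →
    (∀ (F E : Type) [Field F] [NumberField F] [Field E] [NumberField E] [Algebra F E]
      [IsGalois F E], (Module.finrank F E).Prime →
      ∀ (hF : isCompact_glFiniteIntegralLevel 2 F) (π : CuspidalAutomorphicRepData 2 F hF),
        (∃ v : HeightOneSpectrum (𝓞 F),
            ¬ Algebra.IsUnramifiedIn (𝓞 E) v.asIdeal ∧ π.1.IsUnramifiedAt v) →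
        ∀ (hE : isCompact_glFiniteIntegralLevel 2 E),
          ∃ P : CuspidalAutomorphicRepData 2 E hE,
            ∀ (w : HeightOneSpectrum (𝓞 E)) (v : HeightOneSpectrum (𝓞 F)) (α : Multiset ℂ),
              w.asIdeal.under (𝓞 F) = v.asIdeal → Algebra.IsUnramifiedIn (𝓞 E) v.asIdeal →
                π.1.HasSatakeParamAt v α →
                  P.1.HasSatakeParamAt w (α.map (· ^ w.asIdeal.inertiaDeg (𝓞 F)))) →
    IsCMField K → ∀ (π : CuspidalAutomorphicRepData 2 K hcpt), π.1.IsRegularAlgebraic →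
    ∀ (ι : PadicAlgCl ℓ ≃+* ℂ) (E : HeightOneSpectrum (𝓞 K) → Multiset (PadicAlgCl ℓ)),
    (∀ (v : HeightOneSpectrum (𝓞 K)) (α : Multiset ℂ), π.1.HasSatakeParamAt v α →
      ((E v).map fun a ↦ X - C a).prod = arithFrobPolyOfSatake ι v.residueCard 2 α) →
    ∀ {B : Set ℕ},
    (∀ D : ℕ, D.Prime → D ∉ B → ∀ v : HeightOneSpectrum (𝓞 K), ((D : ℕ) : 𝓞 K) ∈ v.asIdeal →
      Algebra.IsUnramifiedAt ℤ v.asIdeal ∧ π.1.IsUnramifiedAt v) →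
    ∀ (i : GoodPrime K (8 * ℓ) B),
    ∃ ρ : FramedGaloisRep (sqrtNegField K i.1) (PadicAlgCl ℓ) 2, ρ.toGaloisRep.IsSemisimple ∧
      CompatibleAE E ρ ∧
      ∀ q : ℕ, q.Prime → q ≠ ℓ → Algebra.IsUnramifiedIn (𝓞 K) (Ideal.span {(q : ℤ)}) →
        π.1.IsUnramifiedAbove q → 8 * q ∣ i.1 + 1 →
        ∀ v : HeightOneSpectrum (𝓞 K), ((q : ℕ) : 𝓞 K) ∈ v.asIdeal →
          ∀ w : HeightOneSpectrum (𝓞 (sqrtNegField K i.1)), w.asIdeal.under (𝓞 K) = v.asIdeal →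
            ∀ α : Multiset ℂ, π.1.HasSatakeParamAt v α →
              ρ.IsUnramifiedAt w ∧
                ρ.HasFrobCharpolyAt w (arithFrobPolyOfSatake ι v.residueCard 2 α) := by
  intro K _ _ hcpt ℓ _ h713 harch hBC hK π hπ ι E hE B hB i
  classical
  have hℓ : ℓ.Prime := Fact.out
  have hD : i.1.Prime := i.2.1
  have hD0 : i.1 ≠ 0 := i.ne_zero
  have hDℓ : 8 * ℓ ∣ i.1 + 1 := i.2.2.1
  -- the member field `L = K(√-D)` and its level structure
  have hL : isCompact_glFiniteIntegralLevel 2 (sqrtNegField K i.1) :=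
    isCompact_glFiniteIntegralLevel_holds 2 (sqrtNegField K i.1)
  have hl2 : (Module.finrank K (sqrtNegField K i.1)).Prime := by
    rw [finrank_sqrtNegField]; exact Nat.prime_two
  -- a ramified place above `D` at which `π` is unramified
  obtain ⟨v₀, hv₀⟩ := exists_heightOneSpectrum_natCast_mem K hD
  obtain ⟨hunrZ, hπv₀⟩ := hB i.1 hD i.2.2.2.1 v₀ hv₀
  have hram : ¬ Algebra.IsUnramifiedIn (𝓞 (sqrtNegField K i.1)) v₀.asIdeal :=
    not_isUnramifiedIn_sqrtNegField v₀ (intValuation_natCast_eq_of_isUnramifiedAt hD v₀ hv₀ hunrZ)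
  -- the strong base change `Π = π_D`, cuspidal and regular algebraic
  obtain ⟨P, hP⟩ := hBC K (sqrtNegField K i.1) hl2 hcpt π ⟨v₀, hram, hπv₀⟩ hL
  have hPra : P.1.IsRegularAlgebraic := isRegularAlgebraic_of_strongBaseChange_two harch hl2 hP hπ
  -- `L` is CM and contains `ℚ(√-D)`, in which `ℓ` and every `q` with `8q ∣ D+1` split
  have hCM : IsCMField (sqrtNegField K i.1) := i.isCMField (Or.inr hK)
  obtain ⟨F₀, hF₀, hF₀split⟩ :=
    exists_intermediateField_hasTwoPrimesOver (K := K) (D := i.1) hD0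
  -- Thm. 7.13 (unramified alternative) for `Π`
  obtain ⟨ρ, hρss, h713'⟩ := h713 (sqrtNegField K i.1) hCM hL ℓ F₀ hF₀ (hF₀split ℓ hℓ hDℓ) P hPra ι
  refine ⟨ρ, hρss, ?_, ?_⟩
  · -- (i) compatibility almost everywhere with the datum of `π`
    have hgood := (finite_setOf_not_exists_goodPrime P.1 P.1.hasSatakeParamAt_cofinite_holds ℓ
      hℓ).compl_mem_cofinite
    have hunrK : ∀ᶠ v : HeightOneSpectrum (𝓞 K) in cofinite,
        Algebra.IsUnramifiedIn (𝓞 (sqrtNegField K i.1)) v.asIdeal := by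
      filter_upwards [(finite_setOf_not_isUnramifiedIn K
        (sqrtNegField K i.1)).compl_mem_cofinite] with v hv
      simpa using hv
    have hπunr : ∀ᶠ v : HeightOneSpectrum (𝓞 K) in cofinite, π.1.IsUnramifiedAt v :=
      π.1.hasSatakeParamAt_cofinite_holds
    show ∀ᶠ w : HeightOneSpectrum (𝓞 (sqrtNegField K i.1)) in cofinite, _
    filter_upwards [hgood, eventually_under (E := sqrtNegField K i.1) hunrK,
      eventually_under (E := sqrtNegField K i.1) hπunr] with w hw hwunr hwπ
    simp only [Set.mem_compl_iff, Set.mem_setOf_eq, not_not] at hw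
    obtain ⟨q, hq, hqℓ, hqunr, hPq, hqw⟩ := hw
    obtain ⟨α, hα⟩ := hwπ (w.under (𝓞 K)) rfl
    have hβ := hP w (w.under (𝓞 K)) α rfl (hwunr _ rfl) hα
    obtain ⟨hunr_w, hch⟩ := h713' q hq hqℓ hqunr hPq w hqw _ hβ
    refine ⟨hunr_w, ?_⟩
    rw [residueCard_eq_residueCard_pow_inertiaDeg (v := w.under (𝓞 K)) (w := w)
      rfl, arithFrobPolyOfSatake_pow] at hch
    have hroots : E (w.under (𝓞 K)) =
        (arithFrobPolyOfSatake ι (w.under (𝓞 K)).residueCard 2 α).roots := by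
      rw [← hE _ α hα, Polynomial.roots_multiset_prod_X_sub_C]
    rw [frobPoly_eq_prod_map_pow, hroots]
    exact hch
  · -- (ii′) at the places over a good `q` with `8q ∣ D + 1`, unramified alternative
    intro q hq hqℓ hKq hπq hqD v hqv w hwv α hα
    -- `Π` is unramified above `q`: every place of `K` over `q` splits completely in `L`
    have hPq : P.1.IsUnramifiedAbove q := by
      intro w' hqw'
      have hqv' : ((q : ℕ) : 𝓞 K) ∈ (w'.under (𝓞 K)).asIdeal :=
        (natCast_mem_iff_natCast_mem_under (K := K) w' q).mp hqw'
      obtain ⟨α', hα'⟩ := hπq _ hqv'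
      have hunr' : Algebra.IsUnramifiedIn (𝓞 (sqrtNegField K i.1)) (w'.under (𝓞 K)).asIdeal :=
        isUnramifiedIn_of_ncard_eq_finrank _ (by
          rw [finrank_sqrtNegField]
          exact ncard_primesOver_sqrtNegField_eq_two _ hq hqv' hqD)
      exact ⟨_, hP w' _ α' rfl hunr' hα'⟩
    -- `q` stays unramified in `L`
    have hLq : Algebra.IsUnramifiedIn (𝓞 (sqrtNegField K i.1)) (Ideal.span {(q : ℤ)}) :=
      isUnramifiedIn_sqrtNegField_of_dvd hq hqD hKq
    have hsplit : (v.asIdeal.primesOver (𝓞 (sqrtNegField K i.1))).ncard =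
        Module.finrank K (sqrtNegField K i.1) := by
      rw [finrank_sqrtNegField]
      exact ncard_primesOver_sqrtNegField_eq_two v hq hqv hqD
    have hunr : Algebra.IsUnramifiedIn (𝓞 (sqrtNegField K i.1)) v.asIdeal :=
      isUnramifiedIn_of_ncard_eq_finrank v hsplit
    have hf : w.asIdeal.inertiaDeg (𝓞 K) = 1 := inertiaDeg_eq_one_of_ncard_eq_finrank v hsplit w hwv
    have hβ : P.1.HasSatakeParamAt w α := by
      have h := hP w v α hwv hunr hα
      rw [hf] at h
      simpa using h
    have hqw : ((q : ℕ) : 𝓞 (sqrtNegField K i.1)) ∈ w.asIdeal := by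
      rw [natCast_mem_iff_natCast_mem_under (K := K) w q]
      change ((q : ℕ) : 𝓞 K) ∈ w.asIdeal.under (𝓞 K)
      rw [hwv]
      exact hqv
    obtain ⟨hunr_w, hch⟩ := h713' q hq hqℓ hLq hPq w hqw α hβ
    refine ⟨hunr_w, ?_⟩
    rwa [residueCard_eq_residueCard_pow_inertiaDeg hwv, hf, pow_one] at hch

end Member

end Summit.Langlands.Langlands.Theorems.GaloisRepGL2CMae

end
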